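import Mathlib.MeasureTheory.Integral.IntervalIntegral.FundThmCalculus
import Mathlib.MeasureTheory.Integral.DominatedConvergence
import Mathlib.Analysis.Normed.Module.FiniteDimension
import Mathlib.Algebra.Order.Floor.Defs
import Literature.Analysis.FunctionSpaces.DiagonalWeakLimits
import HarnessLib

/-!
# Peano's existence theorem

Topic `Literature/Analysis/ODE`. Mathlib (this pin) has the Picard–Lindelöf / Cauchy–Lipschitz
theorem (`IsPicardLindelof.exists_eq_forall_mem_Icc_hasDerivWithinAt`) and Grönwall's inequality,
but not **Peano's theorem**: a merely *continuous* vector field on a finite-dimensional space has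
local integral curves (no uniqueness). This file proves it, following Hartman's text
(P. Hartman, *Ordinary Differential Equations*, 2nd ed., SIAM 2002, Chap. II, §2, Thm 2.1,
p. 10), whose proof uses **Tonelli's device** of a delayed argument instead of Euler polygons or
Schauder's fixed point theorem:

* `Literature.Analysis.ODE.exists_hasDerivWithinAt_of_continuous_of_norm_le` — **global form for
  bounded fields**: if `f : ℝ × E → E` is continuous and `‖f‖ ≤ M` everywhere (`E` a
  finite-dimensional real normed space), then for all `t₀`, `y₀`, `T` there is an `M`-Lipschitz
  `y : ℝ → E` with `y t₀ = y₀` and `y' = f(t, y)` on `[t₀, t₀ + T]` (one-sided at the endpoints).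
* `Literature.Analysis.ODE.peano_existence` — **Hartman's Thm II.2.1 as printed**: `f` continuous
  on the box `R : t₀ ≤ t ≤ t₀ + a, ‖y − y₀‖ ≤ b` with `‖f‖ ≤ M` on `R`; then `y' = f(t, y)`,
  `y(t₀) = y₀` has at least one solution on `[t₀, t₀ + α]`, `α = min a (b / M)`, with values in the
  ball (reduced to the global form by composing `f` with the retractions onto `[t₀, t₀ + a]` and
  onto the closed ball, `Literature.Analysis.ODE.ballRetraction`).

## The proof (Hartman, pp. 10–11)

For `ε > 0` Tonelli's approximate solution `y_ε` solves the *delayed* integral equation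
`y_ε(t) = y₀ + ∫_{t₀}^t f(s, y_ε(max(s − ε, t₀))) ds` (Hartman's (2.1), with the `C¹` history
`y₀(t) ≡ y₀` on `[t₀ − δ, t₀]`), which needs no fixed point: on `[t₀, t₀ + (k+1)ε]` the right-hand
side only sees `y_ε` on `[t₀, t₀ + kε]`. We realise this as the iteration
`Literature.Analysis.ODE.tonelliIter` (`G₀ ≡ y₀`, `G_{k+1}(t) = y₀ + ∫_{t₀}^t f(s, G_k(max(s − ε, t₀))) ds`
for *all* `t`), which stabilises: `G_{k+1} = G_k` on `[t₀, t₀ + kε]`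
(`tonelliIter_succ_eqOn`), so `y_ε := G_{⌈T/ε⌉+1}` solves the delayed equation on `[t₀, t₀ + T]`
(`tonelliApprox_eq`). Each `y_ε` is `M`-Lipschitz with `y_ε(t₀) = y₀` (Hartman's (2.2)). For
`ε = 1/(n+1)` a subsequence converges at every rational time (diagonal extraction in the proper
space `E`, `Literature.Analysis.FunctionSpaces.exists_strictMono_forall_tendsto`), hence at every
time by the uniform Lipschitz bound
(`Literature.Analysis.FunctionSpaces.forall_exists_tendsto_of_subset_closure`); the limit `y` is
`M`-Lipschitz, `y_ε(max(s − ε, t₀)) → y(s)`, and dominated convergence in the delayed equation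
gives `y(t) = y₀ + ∫_{t₀}^t f(s, y(s)) ds` on `[t₀, t₀ + T]`, whence `y' = f(t, y)` by the
fundamental theorem of calculus (Hartman's (1.5) ⇒ (1.1)). Hartman passes to the limit by uniform
convergence and uniform continuity of `f`; pointwise convergence and dominated convergence suffice.

## References

* P. Hartman, *Ordinary Differential Equations*, Classics in Applied Mathematics 38, SIAM (2002),
  Chap. II §2, Theorem 2.1 (Peano) and its proof via Tonelli's device, pp. 10–11.
  [cite: Hartman2002, Thm II.2.1 (p. 10)]
-/

noncomputable section

open MeasureTheory intervalIntegral Set Filter Topology Metric Function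

namespace Literature.Analysis.ODE

variable {E : Type*} [NormedAddCommGroup E] [NormedSpace ℝ E]

/-! ### Tonelli's delayed iteration -/

/-- **Tonelli's delayed iteration** (Hartman 2002, proof of Thm II.2.1, (2.1)): `G₀ ≡ y₀` and
`G_{k+1}(t) = y₀ + ∫_{t₀}^t f(s, G_k(max(s − ε, t₀))) ds`. On `[t₀, t₀ + kε]` the sequence has
stabilised (`tonelliIter_succ_eqOn`), and there `G_k` is Tonelli's approximate solution `y_ε`.
[cite: Hartman2002, proof of Thm II.2.1, (2.1) (p. 10)] -/
def tonelliIter (f : ℝ → E → E) (t₀ : ℝ) (y₀ : E) (ε : ℝ) : ℕ → ℝ → E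
  | 0 => fun _ => y₀
  | k + 1 => fun t => y₀ + ∫ s in t₀..t, f s (tonelliIter f t₀ y₀ ε k (max (s - ε) t₀))

section Iter

variable {f : ℝ → E → E} {t₀ : ℝ} {y₀ : E} {ε M : ℝ}

/-- Unfolding the successor step of Tonelli's iteration. [cite: Hartman2002, proof of Thm II.2.1, (2.1) (p. 10)] -/
theorem tonelliIter_succ_apply (k : ℕ) (t : ℝ) :
    tonelliIter f t₀ y₀ ε (k + 1) t =
      y₀ + ∫ s in t₀..t, f s (tonelliIter f t₀ y₀ ε k (max (s - ε) t₀)) :=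
  rfl

/-- Every iterate starts at `y₀`: `G_k(t₀) = y₀`. [cite: Hartman2002, proof of Thm II.2.1, (2.1) (p. 10)] -/
@[simp]
theorem tonelliIter_apply_self (k : ℕ) : tonelliIter f t₀ y₀ ε k t₀ = y₀ := by
  cases k with
  | zero => rfl
  | succ k => simp [tonelliIter_succ_apply]

omit [NormedSpace ℝ E] in
/-- The integrand of the successor step is continuous when `f` is jointly continuous and the
previous iterate is continuous. [folklore] -/
theorem continuous_tonelliIntegrand (hf : Continuous (uncurry f)) {G : ℝ → E} (hG : Continuous G) :
    Continuous fun s => f s (G (max (s - ε) t₀)) :=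
  hf.comp₂ continuous_id (hG.comp ((continuous_id.sub continuous_const).max continuous_const))

/-- Every Tonelli iterate is continuous (parametric interval integral of a continuous
integrand). [cite: Hartman2002, proof of Thm II.2.1 (p. 10)] -/
theorem continuous_tonelliIter (hf : Continuous (uncurry f)) :
    ∀ k : ℕ, Continuous (tonelliIter f t₀ y₀ ε k)
  | 0 => continuous_const
  | k + 1 => by
    have hg := continuous_tonelliIntegrand (t₀ := t₀) (ε := ε) hf (continuous_tonelliIter hf k)
    exact continuous_const.add
      (intervalIntegral.continuous_primitive (fun a b => hg.intervalIntegrable a b) t₀)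

/-- **Stabilisation of Tonelli's iteration**: `G_{k+1} = G_k` on `[t₀, t₀ + kε]` — on
`[t₀, t₀ + (k+1)ε]` the delayed argument `max(s − ε, t₀)` stays in `[t₀, t₀ + kε]`, where the two
previous iterates agree by induction (this is why (2.1) "is meaningful and defines `y_ε`"
successively on `[t₀, t₀ + ε]`, `[t₀, t₀ + 2ε]`, …; Hartman 2002, p. 10–11). [cite: Hartman2002, proof of Thm II.2.1 (pp. 10–11)] -/
theorem tonelliIter_succ_eqOn (hε : 0 < ε) :
    ∀ k : ℕ, EqOn (tonelliIter f t₀ y₀ ε (k + 1)) (tonelliIter f t₀ y₀ ε k)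
      (Icc t₀ (t₀ + k * ε))
  | 0, t, ht => by
    have h : t = t₀ := le_antisymm (by simpa using ht.2) ht.1
    subst h
    simp
  | k + 1, t, ht => by
    rw [tonelliIter_succ_apply, tonelliIter_succ_apply]
    congr 1
    refine intervalIntegral.integral_congr fun s hs => ?_
    rw [uIcc_of_le ht.1] at hs
    have hτ : max (s - ε) t₀ ∈ Icc t₀ (t₀ + k * ε) := by
      refine ⟨le_max_right _ _, max_le ?_ ?_⟩
      · have h2 := ht.2
        push_cast at h2
        linarith [hs.2]
      · have : (0 : ℝ) ≤ k * ε := by positivity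
        linarith
    exact congrArg (f s) (tonelliIter_succ_eqOn hε k hτ)

/-- **Hartman's (2.2)**: the iterates are `M`-Lipschitz when `‖f‖ ≤ M`
(`‖∫_{t'}^{t} f‖ ≤ M|t − t'|`). [cite: Hartman2002, proof of Thm II.2.1, (2.2) (p. 10)] -/
theorem dist_tonelliIter_succ_le (hf : Continuous (uncurry f)) (hM : ∀ t x, ‖f t x‖ ≤ M) (k : ℕ)
    (t t' : ℝ) :
    dist (tonelliIter f t₀ y₀ ε (k + 1) t) (tonelliIter f t₀ y₀ ε (k + 1) t') ≤ M * |t - t'| := by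
  have hg := continuous_tonelliIntegrand (t₀ := t₀) (ε := ε) hf
    (continuous_tonelliIter (t₀ := t₀) (y₀ := y₀) (ε := ε) hf k)
  rw [tonelliIter_succ_apply, tonelliIter_succ_apply, dist_eq_norm, add_sub_add_left_eq_sub,
    intervalIntegral.integral_interval_sub_left (hg.intervalIntegrable _ _)
      (hg.intervalIntegrable _ _)]
  exact intervalIntegral.norm_integral_le_of_norm_le_const fun s _ => hM _ _

end Iter

/-! ### Tonelli's approximate solutions -/

/-- **Tonelli's approximate solution** `y_ε` on `[t₀, t₀ + T]`: the stabilised iterate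
`G_{⌈T/ε⌉+1}`, which solves the delayed equation
`y_ε(t) = y₀ + ∫_{t₀}^t f(s, y_ε(max(s − ε, t₀))) ds` there (`tonelliApprox_eq`; Hartman 2002,
(2.1)). [cite: Hartman2002, proof of Thm II.2.1, (2.1) (p. 10)] -/
def tonelliApprox (f : ℝ → E → E) (t₀ : ℝ) (y₀ : E) (T ε : ℝ) : ℝ → E :=
  tonelliIter f t₀ y₀ ε (⌈T / ε⌉₊ + 1)

section Approx

variable {f : ℝ → E → E} {t₀ : ℝ} {y₀ : E} {T ε M : ℝ}

/-- `y_ε(t₀) = y₀`. [cite: Hartman2002, proof of Thm II.2.1 (p. 10)] -/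
@[simp]
theorem tonelliApprox_apply_self : tonelliApprox f t₀ y₀ T ε t₀ = y₀ :=
  tonelliIter_apply_self _

/-- `y_ε` is continuous. [cite: Hartman2002, proof of Thm II.2.1 (p. 10)] -/
theorem continuous_tonelliApprox (hf : Continuous (uncurry f)) :
    Continuous (tonelliApprox f t₀ y₀ T ε) :=
  continuous_tonelliIter hf _

/-- Hartman's (2.2) for `y_ε`: `‖y_ε(t) − y_ε(s)‖ ≤ M|t − s|`. [cite: Hartman2002, proof of Thm II.2.1, (2.2) (p. 10)] -/
theorem dist_tonelliApprox_le (hf : Continuous (uncurry f)) (hM : ∀ t x, ‖f t x‖ ≤ M) (t t' : ℝ) :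
    dist (tonelliApprox f t₀ y₀ T ε t) (tonelliApprox f t₀ y₀ T ε t') ≤ M * |t - t'| :=
  dist_tonelliIter_succ_le hf hM _ t t'

/-- **The delayed integral equation** (Hartman's (2.1)) holds for `y_ε` on `[t₀, t₀ + T]`:
`y_ε(t) = y₀ + ∫_{t₀}^t f(s, y_ε(max(s − ε, t₀))) ds` (stabilisation at level `⌈T/ε⌉ + 1`, since
`T ≤ (⌈T/ε⌉ + 1) ε`). [cite: Hartman2002, proof of Thm II.2.1, (2.1) (p. 10)] -/
theorem tonelliApprox_eq (hε : 0 < ε) {t : ℝ} (ht : t ∈ Icc t₀ (t₀ + T)) :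
    tonelliApprox f t₀ y₀ T ε t =
      y₀ + ∫ s in t₀..t, f s (tonelliApprox f t₀ y₀ T ε (max (s - ε) t₀)) := by
  have hT : T ≤ (((⌈T / ε⌉₊ + 1 : ℕ) : ℝ)) * ε := by
    have h1 : T / ε ≤ ⌈T / ε⌉₊ := Nat.le_ceil _
    have h2 : T ≤ (⌈T / ε⌉₊ : ℝ) * ε := by rwa [div_le_iff₀ hε] at h1
    push_cast
    nlinarith
  have hmem : t ∈ Icc t₀ (t₀ + ((⌈T / ε⌉₊ + 1 : ℕ) : ℝ) * ε) := ⟨ht.1, ht.2.trans (by linarith)⟩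
  unfold tonelliApprox
  rw [← tonelliIter_succ_eqOn hε (⌈T / ε⌉₊ + 1) hmem, tonelliIter_succ_apply]

end Approx

/-! ### Peano's theorem, global form for bounded continuous fields -/

/-- The delayed time is `ε`-close to the actual time on `[t₀, ∞)`:
`|max(s − ε, t₀) − s| ≤ ε` for `s ≥ t₀`, `ε ≥ 0`. [folklore] -/
theorem abs_max_sub_sub_le {s ε t₀ : ℝ} (hs : t₀ ≤ s) (hε : 0 ≤ ε) : |max (s - ε) t₀ - s| ≤ ε := by
  rw [abs_le]
  constructor
  · have := le_max_left (s - ε) t₀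
    linarith
  · have := max_le (show s - ε ≤ s by linarith) hs
    linarith

/-- **Peano's existence theorem, global form for bounded fields** (Hartman 2002, Thm II.2.1 and
its proof, pp. 10–11, in the case `b = ∞`): let `E` be a finite-dimensional real normed space,
`f : ℝ × E → E` jointly continuous with `‖f(t, x)‖ ≤ M` for all `(t, x)`. Then for every `t₀`,
`y₀` and `T` there is `y : ℝ → E`, `M`-Lipschitz, with `y(t₀) = y₀` and
`y'(t) = f(t, y(t))` for `t ∈ [t₀, t₀ + T]` (derivative within the interval). Proof by Tonelli's
device and a diagonal extraction, as described in the module docstring; no uniqueness is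
claimed. [cite: Hartman2002, Thm II.2.1 (p. 10)] -/
theorem exists_hasDerivWithinAt_of_continuous_of_norm_le [FiniteDimensional ℝ E] {f : ℝ → E → E}
    {M : ℝ} (hf : Continuous (uncurry f)) (hM : ∀ t x, ‖f t x‖ ≤ M) (t₀ : ℝ) (y₀ : E) (T : ℝ) :
    ∃ y : ℝ → E, y t₀ = y₀ ∧ (∀ t t', dist (y t) (y t') ≤ M * |t - t'|) ∧
      ∀ t ∈ Icc t₀ (t₀ + T), HasDerivWithinAt y (f t (y t)) (Icc t₀ (t₀ + T)) t := by
  haveI : CompleteSpace E := FiniteDimensional.complete ℝ E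
  have hM0 : 0 ≤ M := (norm_nonneg _).trans (hM t₀ y₀)
  -- Tonelli's approximate solutions with `ε = 1/(n+1)`
  set δ : ℕ → ℝ := fun n => 1 / ((n : ℝ) + 1) with hδ
  have hδpos : ∀ n, 0 < δ n := fun n => by rw [hδ]; positivity
  set Y : ℕ → ℝ → E := fun n => tonelliApprox f t₀ y₀ T (δ n) with hY
  have hY0 : ∀ n, Y n t₀ = y₀ := fun n => tonelliApprox_apply_self
  have hYlip : ∀ n t t', dist (Y n t) (Y n t') ≤ M * |t - t'| := fun n t t' =>
    dist_tonelliApprox_le hf hM t t'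
  have hYcont : ∀ n, Continuous (Y n) := fun n => continuous_tonelliApprox hf
  have hYeq : ∀ n, ∀ t ∈ Icc t₀ (t₀ + T),
      Y n t = y₀ + ∫ s in t₀..t, f s (Y n (max (s - δ n) t₀)) := fun n t ht =>
    tonelliApprox_eq (hδpos n) ht
  -- diagonal extraction at rational times
  obtain ⟨φ, hφ, hlimQ⟩ := FunctionSpaces.exists_strictMono_forall_tendsto
    (fun n (q : ℚ) => Y n q) fun q => ⟨y₀, M * |(q : ℝ) - t₀|, fun n => by
      rw [mem_closedBall, ← hY0 n]
      exact hYlip n _ _⟩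
  -- convergence at every time by the uniform Lipschitz bound
  have hconv : ∀ t : ℝ, ∃ l, Tendsto (fun n => Y (φ n) t) atTop (𝓝 l) := by
    have hSD : (univ : Set ℝ) ⊆ closure (range ((↑) : ℚ → ℝ)) := by
      rw [Rat.denseRange_cast.closure_range]
    have key := FunctionSpaces.forall_exists_tendsto_of_subset_closure
      (x := fun n t => Y (φ n) t) (S := univ) (D := range ((↑) : ℚ → ℝ)) hSD
      (by rintro _ ⟨q, rfl⟩; exact hlimQ q) (fun ε hε => ⟨ε / (M + 1), by positivity,
        fun n t _ d _ htd => ?_⟩)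
    · exact fun t => key t (mem_univ t)
    · calc dist (Y (φ n) t) (Y (φ n) d) ≤ M * |t - d| := hYlip _ _ _
        _ ≤ M * (ε / (M + 1)) := by
            rw [← Real.dist_eq]; exact mul_le_mul_of_nonneg_left htd.le hM0
        _ < ε := by
            rw [mul_div_assoc', div_lt_iff₀ (by positivity)]
            nlinarith
  choose y hy using hconv
  have hy0 : y t₀ = y₀ :=
    tendsto_nhds_unique (hy t₀) (by simp only [hY0]; exact tendsto_const_nhds)
  have hylip : ∀ t t', dist (y t) (y t') ≤ M * |t - t'| := fun t t' =>
    FunctionSpaces.dist_lim_le_of_dist_le (hy t) (hy t') fun n => hYlip _ _ _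
  have hycont : Continuous y := by
    refine (LipschitzWith.of_dist_le_mul (K := M.toNNReal) fun t t' => ?_).continuous
    rw [Real.coe_toNNReal _ hM0, Real.dist_eq]
    exact hylip t t'
  -- the delayed arguments converge: `Y (φ n) (max (s - δ (φ n)) t₀) → y s` for `s ≥ t₀`
  have hδφ : Tendsto (fun n => δ (φ n)) atTop (𝓝 0) := by
    have h1 : Tendsto (fun n => δ n) atTop (𝓝 0) := tendsto_one_div_add_atTop_nhds_zero_nat
    exact h1.comp hφ.tendsto_atTop
  have hdelay : ∀ s, t₀ ≤ s →
      Tendsto (fun n => Y (φ n) (max (s - δ (φ n)) t₀)) atTop (𝓝 (y s)) := by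
    intro s hs
    rw [tendsto_iff_dist_tendsto_zero]
    have hbound : ∀ n, dist (Y (φ n) (max (s - δ (φ n)) t₀)) (y s) ≤
        M * δ (φ n) + dist (Y (φ n) s) (y s) := fun n => by
      calc dist (Y (φ n) (max (s - δ (φ n)) t₀)) (y s)
          ≤ dist (Y (φ n) (max (s - δ (φ n)) t₀)) (Y (φ n) s) + dist (Y (φ n) s) (y s) :=
            dist_triangle _ _ _
        _ ≤ M * δ (φ n) + dist (Y (φ n) s) (y s) := by
            refine add_le_add ((hYlip _ _ _).trans ?_) le_rfl
            exact mul_le_mul_of_nonneg_left (abs_max_sub_sub_le hs (hδpos _).le) hM0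
    have hlim : Tendsto (fun n => M * δ (φ n) + dist (Y (φ n) s) (y s)) atTop (𝓝 0) := by
      have h1 : Tendsto (fun n => M * δ (φ n)) atTop (𝓝 0) := by
        simpa using hδφ.const_mul M
      have h2 : Tendsto (fun n => dist (Y (φ n) s) (y s)) atTop (𝓝 0) :=
        (tendsto_iff_dist_tendsto_zero.1 (hy s))
      simpa using h1.add h2
    exact squeeze_zero (fun n => dist_nonneg) hbound hlim
  -- pass to the limit in the delayed integral equation
  have hinteq : ∀ t ∈ Icc t₀ (t₀ + T), y t = y₀ + ∫ s in t₀..t, f s (y s) := by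
    intro t ht
    have hlhs : Tendsto (fun n => Y (φ n) t) atTop (𝓝 (y t)) := hy t
    have hrhs : Tendsto (fun n => y₀ + ∫ s in t₀..t, f s (Y (φ n) (max (s - δ (φ n)) t₀)))
        atTop (𝓝 (y₀ + ∫ s in t₀..t, f s (y s))) := by
      refine tendsto_const_nhds.add ?_
      refine intervalIntegral.tendsto_integral_filter_of_dominated_convergence (fun _ => M)
        (Eventually.of_forall fun n => ?_) (Eventually.of_forall fun n => ?_)
        intervalIntegrable_const (ae_of_all _ fun s hs => ?_)
      · exact (continuous_tonelliIntegrand hf (hYcont _)).aestronglyMeasurable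
      · exact ae_of_all _ fun s _ => hM _ _
      · have hs' : t₀ ≤ s := by
          rw [uIoc_of_le ht.1] at hs
          exact hs.1.le
        have hcont : ContinuousAt (uncurry f) (s, y s) := hf.continuousAt
        have h2 : Tendsto (fun n => (s, Y (φ n) (max (s - δ (φ n)) t₀))) atTop (𝓝 (s, y s)) :=
          tendsto_const_nhds.prodMk_nhds (hdelay s hs')
        exact hcont.tendsto.comp h2
    have heq : ∀ n, Y (φ n) t = y₀ + ∫ s in t₀..t, f s (Y (φ n) (max (s - δ (φ n)) t₀)) :=
      fun n => hYeq (φ n) t ht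
    exact tendsto_nhds_unique (hlhs.congr heq) hrhs
  -- differentiate
  refine ⟨y, hy0, hylip, fun t ht => ?_⟩
  have hg : Continuous fun s => f s (y s) := hf.comp₂ continuous_id hycont
  have hG : HasDerivAt (fun u => y₀ + ∫ s in t₀..u, f s (y s)) (f t (y t)) t :=
    ((hg.integral_hasStrictDerivAt t₀ t).hasDerivAt).const_add y₀
  exact hG.hasDerivWithinAt.congr_of_mem (fun u hu => hinteq u hu) ht

/-! ### Peano's theorem on a box (Hartman's Theorem II.2.1) -/

section Retraction

variable (y₀ : E) (b : ℝ)

/-- The **radial retraction** of `E` onto the closed ball `B̄(y₀, b)`, `b > 0`: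
`x ↦ y₀ + (b / max b ‖x − y₀‖) (x − y₀)`; the identity on the ball. [folklore] -/
def ballRetraction (x : E) : E :=
  y₀ + (b / max b ‖x - y₀‖) • (x - y₀)

variable {y₀ b}

/-- The radial retraction is continuous (`max b ‖x − y₀‖ ≥ b > 0`). [folklore] -/
theorem continuous_ballRetraction (hb : 0 < b) : Continuous (ballRetraction y₀ b) := by
  unfold ballRetraction
  refine continuous_const.add (Continuous.smul ?_ (continuous_id.sub continuous_const))
  refine continuous_const.div (continuous_const.max (continuous_id.sub continuous_const).norm)
    fun x => ?_
  exact (lt_of_lt_of_le hb (le_max_left _ _)).ne'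

/-- The radial retraction is the identity on the closed ball. [folklore] -/
theorem ballRetraction_of_mem (hb : 0 < b) {x : E} (hx : x ∈ closedBall y₀ b) :
    ballRetraction y₀ b x = x := by
  rw [mem_closedBall, dist_eq_norm] at hx
  unfold ballRetraction
  rw [max_eq_left hx, div_self hb.ne', one_smul, add_sub_cancel]

/-- The radial retraction takes values in the closed ball. [folklore] -/
theorem ballRetraction_mem (hb : 0 < b) (x : E) : ballRetraction y₀ b x ∈ closedBall y₀ b := by
  rw [mem_closedBall, dist_eq_norm]
  unfold ballRetraction
  rw [add_sub_cancel_left, norm_smul, norm_div, Real.norm_of_nonneg hb.le,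
    Real.norm_of_nonneg (hb.le.trans (le_max_left _ _))]
  have hm : 0 < max b ‖x - y₀‖ := lt_of_lt_of_le hb (le_max_left _ _)
  rw [div_mul_eq_mul_div, div_le_iff₀ hm]
  exact mul_le_mul_of_nonneg_left (le_max_right _ _) hb.le

end Retraction

/-- **Peano's existence theorem** (Hartman 2002, Thm II.2.1, p. 10): let `y, f ∈ ℝ^d` — here
`E` a finite-dimensional real normed space with any norm ("|y| can be any convenient norm on
`ℝ^d`") —, `f(t, y)` continuous on `R : t₀ ≤ t ≤ t₀ + a, ‖y − y₀‖ ≤ b`, `M` a bound for `‖f‖` on `R`,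
`α = min(a, b/M)`. Then `y' = f(t, y)`, `y(t₀) = y₀` possesses at least one solution `y = y(t)`
on `[t₀, t₀ + α]` (derivative within the interval at the endpoints), and it stays in the ball.
Hypotheses `a ≥ 0`, `b > 0`, `M > 0` make the printed data meaningful. Reduced to the global form
`exists_hasDerivWithinAt_of_continuous_of_norm_le` by extending `f` continuously and boundedly
to `ℝ × E` through the retractions onto `[t₀, t₀ + a]` (`Set.projIcc`) and onto the ball
(`ballRetraction`); the `M`-Lipschitz solution from `y₀` stays in `R` on `[t₀, t₀ + α]` since
`Mα ≤ b`. [cite: Hartman2002, Thm II.2.1 (p. 10)] -/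
theorem peano_existence [FiniteDimensional ℝ E] {f : ℝ → E → E} {t₀ a b M : ℝ} {y₀ : E}
    (ha : 0 ≤ a) (hb : 0 < b) (hM : 0 < M)
    (hf : ContinuousOn (uncurry f) (Icc t₀ (t₀ + a) ×ˢ closedBall y₀ b))
    (hfM : ∀ t ∈ Icc t₀ (t₀ + a), ∀ x ∈ closedBall y₀ b, ‖f t x‖ ≤ M) :
    ∃ y : ℝ → E, y t₀ = y₀ ∧ ∀ t ∈ Icc t₀ (t₀ + min a (b / M)),
      y t ∈ closedBall y₀ b ∧
        HasDerivWithinAt y (f t (y t)) (Icc t₀ (t₀ + min a (b / M))) t := by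
  set α : ℝ := min a (b / M) with hα
  have hle : t₀ ≤ t₀ + a := by linarith
  -- continuous bounded extension of `f` to `ℝ × E`
  set g : ℝ → E → E := fun t x => f (projIcc t₀ (t₀ + a) hle t) (ballRetraction y₀ b x) with hg
  have hgc : Continuous (uncurry g) := by
    have h1 : Continuous fun p : ℝ × E =>
        ((projIcc t₀ (t₀ + a) hle p.1 : ℝ), ballRetraction y₀ b p.2) :=
      (continuous_subtype_val.comp (continuous_projIcc.comp continuous_fst)).prodMk
        ((continuous_ballRetraction hb).comp continuous_snd)
    have h2 : ∀ p : ℝ × E, ((projIcc t₀ (t₀ + a) hle p.1 : ℝ), ballRetraction y₀ b p.2) ∈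
        Icc t₀ (t₀ + a) ×ˢ closedBall y₀ b :=
      fun p => ⟨(projIcc t₀ (t₀ + a) hle p.1).2, ballRetraction_mem hb _⟩
    exact hf.comp_continuous h1 h2
  have hgM : ∀ t x, ‖g t x‖ ≤ M := fun t x =>
    hfM _ (projIcc t₀ (t₀ + a) hle t).2 _ (ballRetraction_mem hb x)
  obtain ⟨y, hy0, hylip, hyder⟩ :=
    exists_hasDerivWithinAt_of_continuous_of_norm_le hgc hgM t₀ y₀ α
  -- the solution stays in the box on `[t₀, t₀ + α]`
  have hball : ∀ t ∈ Icc t₀ (t₀ + α), y t ∈ closedBall y₀ b := fun t ht => by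
    rw [mem_closedBall, ← hy0]
    calc dist (y t) (y t₀) ≤ M * |t - t₀| := hylip t t₀
      _ = M * (t - t₀) := by rw [abs_of_nonneg (by linarith [ht.1])]
      _ ≤ M * (b / M) := mul_le_mul_of_nonneg_left (by linarith [ht.2, min_le_right a (b / M)]) hM.le
      _ = b := mul_div_cancel₀ b hM.ne'
  have htime : ∀ t ∈ Icc t₀ (t₀ + α), t ∈ Icc t₀ (t₀ + a) := fun t ht =>
    ⟨ht.1, ht.2.trans (by linarith [min_le_left a (b / M)])⟩
  refine ⟨y, hy0, fun t ht => ⟨hball t ht, ?_⟩⟩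
  have heq : g t (y t) = f t (y t) := by
    simp only [hg, projIcc_of_mem hle (htime t ht), ballRetraction_of_mem hb (hball t ht)]
  rw [← heq]
  exact hyder t ht

end Literature.Analysis.ODE
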